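import Summits.CriticalPhenomena.PercolationContinuityZ3.Theorems.PercNearOneGluingNoHeavyLowerTailMixCSHHubProjection
import Summits.CriticalPhenomena.PercolationContinuityZ3.Theorems.PercNearOneGluingNoHeavyLowerTailKNConj4PreMargin
import HarnessLib

/-!
# The MIXED conditioned slack hierarchy (hub observer) — peeling tools
# (the `o`-entry of the level forms, the `Ψ_iso` integral, and peeling a relay off the hub entry)

Support file (`--supports stmt-CriticalPhenomena-4575`), prover `prim-ineq-gen-7` (gen 8).  No definitions, no named facts, no sorries.
Memo `prim-ineq-gen-7/PROOF-Q9-MIXED-CSH.md` §2 ("the `o`-entry has coefficient `+1`") and §4 step (P); roadmap §9.4.  Consumed by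
`…MixCSHPeel.lean` (Theorem M2 from Theorem M1).

* `MixCSH.slForm_single_label`, `cshMarg_single_label`, `cshMarg_mono_label` — the level form `CSH.cshMarg` is monotone (coefficient `+1`) in
  the value at the hub label `o` (not a decoy, `o ≠ v`): the device that lets every repair of the mixed theory be an INEQUALITY at the hub.
* `MixCSH.setIntegral_psiIso` — `∫_A Ψ_iso(C_k) = μ(A) − μ(A ∩ {C_k = ∅})`.
* `MixCSH.mixPreF_hub_peel` — `Δ^G_o(X∖k) + ∫_{D_k ∩ hubEv Σ k (X∖k)} (F(C(k)) − F(C(c))) ≤ Δ^G_o(X)` (hub form).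
[cite: KozmaNitzan2024, Question 9 (§5.5 p. 36), Conj. 4 (p. 32)] [cite: VandenbergHaggstromKahn2005, §2.1 Lemma 2.4 (p. 10)]
-/

noncomputable section

namespace Summit.CriticalPhenomena.PercolationContinuityZ3.Theorems

open MeasureTheory Set Literature.Probability.LatticeModels Literature.Probability.Percolation
open scoped Classical
open KNPreFKG CSH PreFKGSurplus

namespace MixCSH

variable {V : Type*}

/-- The decoys of `mixDecoyList w Σ o A D` are the members of `D`. [folklore] -/
theorem mem_mixDecoyList (w : Sym2 V → unitInterval) (Sig : Set V) (o : V) :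
    ∀ (A : Set V) (D : List V) (dc : V × (V → ℝ)), dc ∈ mixDecoyList w Sig o A D → dc.1 ∈ D
  | _, [], dc, h => by simp [mixDecoyList] at h
  | A, d :: D, dc, h => by
    simp only [mixDecoyList, List.mem_cons] at h
    rcases h with rfl | h
    · exact List.mem_cons_self
    · exact List.mem_cons_of_mem _ (mem_mixDecoyList w Sig o (insert d A) D dc h)

/-- The level form does not move the indicator of a label which is not a decoy: `sl_L[δ_o] = δ_o`. [folklore] -/
theorem slForm_single_label [DecidableEq V] (o : V) :
    ∀ (L : List (V × (V → ℝ))), (∀ dc ∈ L, dc.1 ≠ o) → slForm L (Pi.single o (1 : ℝ)) = Pi.single o (1 : ℝ)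
  | [], _ => rfl
  | dc :: L, h => by
    rw [slForm_cons_eq]
    have hstep : slStep dc (Pi.single o (1 : ℝ)) = Pi.single o (1 : ℝ) := by
      funext u
      simp only [slStep, Pi.single_eq_of_ne (h dc List.mem_cons_self), mul_zero, sub_zero]
    rw [hstep]
    exact slForm_single_label o L fun dc' hdc' => h dc' (List.mem_cons_of_mem _ hdc')

/-- **The `o`-entry of the level form has coefficient `+1`**: `Marg_L[δ_o] = 1` when `o` is neither a decoy nor the second observer.
(transcription of the cell memo prim-ineq-gen-7 PROOF-Q9-MIXED-CSH.md §2) [folklore] -/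
theorem cshMarg_single_label [DecidableEq V] (L : List (V × (V → ℝ))) (p : ℝ) {o v : V} (hov : o ≠ v)
    (hL : ∀ dc ∈ L, dc.1 ≠ o) :
    cshMarg L p o v (Pi.single o (1 : ℝ)) = 1 := by
  simp only [cshMarg, slForm_single_label o L hL, Pi.single_eq_same, Pi.single_eq_of_ne hov.symm, mul_zero, sub_zero]

/-- **Monotonicity of the level form in the `o`-entry**: if `f ≥ g` at `o` and `f = g` elsewhere, then `Marg_L[f] ≥ Marg_L[g]`
(`o` not a decoy, `o ≠ v`). [folklore] -/
theorem cshMarg_mono_label [DecidableEq V] (L : List (V × (V → ℝ))) (p : ℝ) {o v : V} (hov : o ≠ v) (hL : ∀ dc ∈ L, dc.1 ≠ o)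
    (f g : V → ℝ) (ho : g o ≤ f o) (hfg : ∀ u, u ≠ o → f u = g u) :
    cshMarg L p o v g ≤ cshMarg L p o v f := by
  have hf : f = g + (f o - g o) • Pi.single o (1 : ℝ) := by
    funext u
    by_cases hu : u = o
    · subst hu; simp
    · simp [Pi.single_eq_of_ne hu, hfg u hu]
  rw [hf, cshMarg_add, cshMarg_smul, cshMarg_single_label L p hov hL, mul_one]
  linarith

variable {n : ℕ}

/-- `∫_A Ψ_iso(C_k) = μ(A) − μ(A ∩ {C_k = ∅})`. [folklore] -/
theorem setIntegral_psiIso (μ : Measure (BondConfig (Fin n))) [IsFiniteMeasure μ] (A : Set (BondConfig (Fin n))) (k : Fin n) :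
    ∫ ω in A, psiIso (openEdgeCluster ω k) ∂μ = μ.real A - μ.real (A ∩ {ω | openEdgeCluster ω k = ∅}) := by
  classical
  have hmeas : ∀ S : Set (BondConfig (Fin n)), MeasurableSet S := fun _ => MeasurableSet.of_discrete
  have hsplit := (integral_inter_add_sdiff (hmeas {ω : BondConfig (Fin n) | openEdgeCluster ω k = ∅})
    ((Integrable.of_finite (f := fun ω => psiIso (openEdgeCluster ω k)) (μ := μ)).integrableOn (s := A))).symm
  rw [hsplit]
  have ha : ∫ ω in A ∩ {ω | openEdgeCluster ω k = ∅}, psiIso (openEdgeCluster ω k) ∂μ = 0 := by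
    rw [setIntegral_congr_fun (hmeas _) (fun ω hω => by
      show psiIso (openEdgeCluster ω k) = (0 : ℝ)
      simp only [psiIso, if_pos (show openEdgeCluster ω k = ∅ from hω.2)])]
    simp
  have hb : ∫ ω in A \ {ω | openEdgeCluster ω k = ∅}, psiIso (openEdgeCluster ω k) ∂μ =
      μ.real (A \ {ω | openEdgeCluster ω k = ∅}) := by
    rw [setIntegral_congr_fun (hmeas _) (fun ω hω => by
      show psiIso (openEdgeCluster ω k) = (1 : ℝ)
      simp only [psiIso, if_neg (show openEdgeCluster ω k ≠ ∅ from hω.2)]), setIntegral_const, smul_eq_mul, mul_one]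
  rw [ha, hb, zero_add]
  have := measureReal_inter_add_sdiff (μ := μ) (s := A) (hmeas {ω : BondConfig (Fin n) | openEdgeCluster ω k = ∅}) (measure_ne_top _ _)
  linarith

/-- **Peeling a relay off the hub entry (memo §4 (P)).**  For `k ∈ X`, `c ∈ X.erase k` and `F` monotone on vertex sets:
`Δ^G_o(X.erase k) + ∫_{D_k ∩ hubEv Σ k (X.erase k)} (F(C(k)) − F(C(c))) ≤ Δ^G_o(X)` (hub form; `{Σ ↔ X} = {Σ ↔ X∖k} ⊔ hubEv Σ k (X∖k)`, and on
the new part `C_Σ ⊇ C(k)`, `C^Σ_c = C(c)`). [cite: KozmaNitzan2024, Question 9 (§5.5 p. 36)] -/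
theorem mixPreF_hub_peel (w : Sym2 (Fin n) → unitInterval) (Sig : Set (Fin n)) (o : Fin n) (X : Finset (Fin n)) (c k : Fin n)
    (hkX : k ∈ X) (hcX' : c ∈ X.erase k) (F : Set (Fin n) → ℝ) (hF : ∀ S S' : Set (Fin n), S ⊆ S' → F S ≤ F S') :
    mixPreF w Sig o (X.erase k) c F o +
        ∫ ω in {ω : BondConfig (Fin n) | ∀ a ∈ (↑(X.erase k) : Set (Fin n)), ¬ (openGraph ω).Reachable k a} ∩
          hubEv Sig k (↑(X.erase k) : Set (Fin n)), (F (openCluster ω k) - F (openCluster ω c)) ∂(prodBernoulli w) ≤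
      mixPreF w Sig o X c F o := by
  classical
  rw [mixPreF_hub, mixPreF_hub]
  set μ := prodBernoulli w with hμ
  have hmeas : ∀ S : Set (BondConfig (Fin n)), MeasurableSet S := fun _ => MeasurableSet.of_discrete
  have hint : ∀ (g : BondConfig (Fin n) → ℝ), Integrable g μ := fun g => Integrable.of_finite
  set X' := X.erase k with hX'
  set Dk : Set (BondConfig (Fin n)) := {ω : BondConfig (Fin n) | ∀ a ∈ (↑X' : Set (Fin n)), ¬ (openGraph ω).Reachable k a} with hDk
  set Hk : Set (BondConfig (Fin n)) := hubEv Sig k (↑X' : Set (Fin n)) with hHk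
  set EX : Set (BondConfig (Fin n)) := {ω | ∃ σ ∈ Sig, ∃ a ∈ X, (openGraph ω).Reachable a σ} with hEX
  set EX' : Set (BondConfig (Fin n)) := {ω | ∃ σ ∈ Sig, ∃ a ∈ X', (openGraph ω).Reachable a σ} with hEX'
  have hX'X : ∀ a ∈ X', a ∈ X := fun a ha => Finset.mem_of_mem_erase ha
  have hHkDk : Hk ⊆ Dk := by
    rintro ω ⟨⟨σ, hσ, hkσ⟩, hno⟩ a ha h'
    exact hno σ hσ a ha (h'.symm.trans hkσ)
  have hsub : EX' ⊆ EX := by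
    rintro ω ⟨σ, hσ, a, ha, h'⟩; exact ⟨σ, hσ, a, hX'X a ha, h'⟩
  have hdiff : EX \ EX' = Dk ∩ Hk := by
    ext ω
    constructor
    · rintro ⟨⟨σ, hσ, a, ha, haσ⟩, hno⟩
      have hno' : ∀ σ' ∈ Sig, ∀ a' ∈ (↑X' : Set (Fin n)), ¬ (openGraph ω).Reachable a' σ' :=
        fun σ' hσ' a' ha' h' => hno ⟨σ', hσ', a', Finset.mem_coe.1 ha', h'⟩
      have hak : a = k := by
        by_contra hak
        exact hno ⟨σ, hσ, a, Finset.mem_erase.2 ⟨hak, ha⟩, haσ⟩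
      subst hak
      exact ⟨hHkDk ⟨⟨σ, hσ, haσ⟩, hno'⟩, ⟨σ, hσ, haσ⟩, hno'⟩
    · rintro ⟨_, ⟨σ, hσ, hkσ⟩, hno⟩
      exact ⟨⟨σ, hσ, k, hkX, hkσ⟩, fun ⟨σ', hσ', a', ha', h'⟩ => hno σ' hσ' a' (Finset.mem_coe.2 ha') h'⟩
  -- the abstract bookkeeping: `∫_{EX} h = ∫_{EX'} h + ∫_{Dk ∩ Hk} h` and `∫_{Dk ∩ Hk} g ≤ ∫_{Dk ∩ Hk} h`
  have key : ∀ (h g : BondConfig (Fin n) → ℝ), (∫ ω in Dk ∩ Hk, g ω ∂μ ≤ ∫ ω in Dk ∩ Hk, h ω ∂μ) →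
      (∫ ω in EX', h ω ∂μ) + ∫ ω in Dk ∩ Hk, g ω ∂μ ≤ ∫ ω in EX, h ω ∂μ := by
    intro h g hge
    have e := integral_inter_add_sdiff (hmeas EX') ((hint h).integrableOn (s := EX))
    rw [inter_eq_right.2 hsub, hdiff] at e
    linarith
  refine key _ _ (setIntegral_mono_on (hint _).integrableOn (hint _).integrableOn (hmeas _) fun ω hω => ?_)
  obtain ⟨_, ⟨σ, hσ, hkσ⟩, hno⟩ := hω
  have hcno : ¬ ∃ σ' ∈ Sig, (openGraph ω).Reachable c σ' :=
    fun ⟨σ', hσ', h'⟩ => hno σ' hσ' c (Finset.mem_coe.2 hcX') h'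
  simp only [if_neg hcno, sub_le_sub_iff_right]
  refine hF _ _ fun z hz => mem_iUnion₂.2 ⟨σ, hσ, ?_⟩
  exact hkσ.symm.trans hz


end MixCSH

end Summit.CriticalPhenomena.PercolationContinuityZ3.Theorems
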